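import Summits.HodgeConjecture.HodgeConjecture.Theorems.Ring2HypothesesDescentMotivatedRungs
import Summits.HodgeConjecture.HodgeConjecture.Theorems.Ring2AbelianAllAndreStandardConjecturesAbelianVariety
import Summits.HodgeConjecture.HodgeConjecture.Theorems.Ring2AbelianAllAndreFibreClass
import Summits.HodgeConjecture.HodgeConjecture.Theorems.PeriodDeficiencyHodgeConjectureQbarStubLefschetzTransfer
import Literature.AlgebraicGeometry.HodgeTheory.HardLefschetzNFoldHolds
import Literature.AlgebraicGeometry.HodgeTheory.MotivatedClassesPointAuxiliary
import Literature.AlgebraicGeometry.HodgeTheory.VanishingCohomologyNontrivialProofs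
import Literature.AlgebraicGeometry.HodgeTheory.GlobalInvariantCyclesProofs
import Literature.AlgebraicGeometry.Motives.ComplexPointsOrientation
import Literature.AlgebraicTopology.SingularHomology.CohomologyOfPoint
import HarnessLib

/-!
# Ring 2 — hypotheses layer, descent axis: row b05 IS ITS UPPER HALF — Lieberman's `*_L` transfers
# `A_mot ⊆ A` on an abelian variety from codimension `g − p` down to `p`; the NUMERICAL and RANK forms of row b05

HONEST FRAMING (page 1, verbatim the cell's standing line): **research route conditional on HC_CM; not a
corollary; Q11.4-sentence-2 already refuted in dim ≥ 3.** Nothing in this file proves a case of the Hodge conjecture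
or of a standard conjecture beyond what the tree already has; nothing asserts `HC_CM`
(= `Theses.RankFourFaces.CMAbelianHodge`, a BINDER of the cell, not used here), `HC_AV`, row b05 or its modulus `X`.

Hodge ladder STAGE 3, `BINDER-OWNERS.md` row **b05** (`Ring2.Hypotheses.MotivatedImpliesAlgebraicAV`, `Ring2HypothesesDescent.lean` l.177:
André's motivated classes on every complex abelian variety are algebraic; "published modulo `X`"). The row's kernel residue so far
(gen 0, `Ring2HypothesesDescentMotivatedRungs` :193) was the MIDDLE RANGE `2 ≤ p ≤ g − 2` (`g = dim A`): below it Lefschetz `(1,1)`,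
above it hard Lefschetz. This file halves it, with two tools the AbelianAll sub-cell landed on 2026-08-21 (count once THEIRS): parts
XXII-c/XXII-h — Lieberman's `B(A)`, André's `*_L : H^{2(g−p)}(A(ℂ)) → H^{2p}(A(ℂ))` is induced by an algebraic correspondence for EVERY
complex abelian variety (`AbelianAll.standardConjectureBStar_abelianVariety`), and Lieberman's `D(A)`, the cup pairing `Nᵖ × N^{g−p} → H^{2g}`
on the `ℂ`-spans of algebraic classes is non-degenerate on both sides (`AbelianAll.nondegenerate_algebraicClasses_abelianVariety`) — and
the tree's unconditional "`A_mot(X)` is a module over the divisor classes" (`Theorems.cupProduct_divisor_mem_motivatedClasses`, André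
Prop. 2.1 (i) in the weak form the projection formula gives) and "algebraic correspondences preserve algebraic classes"
(`AbelianAll.map_mem_algebraicClasses_of_isAlgebraicCorrespondence`, Voisin II Prop. 9.21).

* §1 **TRANSFER, any smooth projective `X` of dimension `n`** (`motivatedClasses_le_algebraicClasses_of_upper_of_isAlgebraicCorrespondence`):
  for `2p + j = n`, if `*_L : H^{2(p+j)} → H^{2p}` is induced by an algebraic correspondence (ONE bidegree of `B(X)`) and
  `A_mot^{p+j}(X) ⊆ N^{p+j}`, then `A_motᵖ(X) ⊆ Nᵖ`: `ξ ∈ A_motᵖ ⟹ Lʲ ξ ∈ A_mot^{p+j} ⊆ N^{p+j}` and `ξ = *_L(Lʲ ξ) ∈ Nᵖ`. Hence under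
  `B⋆(X, η)` the statement `A_mot(X) = A(X)` FOR `X` is its upper half `n ≤ 2p ≤ 2n − 4`
  (`forall_motivatedClasses_le_algebraicClasses_of_upperHalf_of_standardConjectureBStar`; the tree's `B ⟹ A_mot = A` needs `B` for the
  auxiliary products `X × Y` as well).
* §2 **ROW b05 IS ITS UPPER HALF** (`motivatedImpliesAlgebraicAV_iff_upperHalf`): `MotivatedImpliesAlgebraicAV ⟺` on every complex abelian
  variety `A` the motivated classes of codimension `p` with `g ≤ 2p ≤ 2g − 4` — CYCLE DIMENSION `2 ≤ g − p ≤ g/2` — are algebraic; PER `A`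
  (`forall_motivatedClasses_le_algebraicClasses_abelianVariety_of_upperHalf`). For `g ≤ 5` ONE codimension carries the row, `p = g − 2`
  (motivated SURFACE classes; `forall_motivatedClasses_le_algebraicClasses_abelianVariety_of_dim_le_five`: for `g = 4` the middle, for
  `g = 5` it discards `p = 2`). (For rational `(p,p)`-classes the same transfer is classical — `Λ` is algebraic on `A`.)
* §3 **NUMERICAL FORM** (`motivatedClasses_le_algebraicClasses_abelianVariety_iff_numerical`): for `p + q = g`, `A_motᵖ(A) ⊆ Nᵖ(A) ⟺` no
  non-zero motivated class of codimension `p` is cup-orthogonal to `N^q(A)` — by `D(A)` every `ξ ∈ H^{2p}` has an algebraic "shadow"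
  `a ∈ Nᵖ` with `ξ − a ⊥ N^q` (linear algebra over the line `H^{2g}`), and `ξ − a` is motivated. So row b05 `⟺` "every non-zero
  motivated class on a complex abelian variety has a non-zero intersection number with some algebraic cycle of complementary
  dimension" (`motivatedImpliesAlgebraicAV_iff_numerical`); with §2 only cycle dimensions `2 ≤ q ≤ g/2` need testing (`…_iff_numerical_upperHalf`).
* §4 **RANK FORM**: `A_motᵖ ⊆ Nᵖ ⟺ rk Nᵖ = rk A_motᵖ` (any `X`); `rk A_motᵖ(X) ≤ rk A_mot^{n−p}(X)` for `2p ≤ n` (`Lʲ` injective, any `X`);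
  `rk Nᵖ(A) = rk N^{g−p}(A)` (Lieberman); hence the MOTIVATED DEFECT `δ_p(A) := rk A_motᵖ(A) − rk Nᵖ(A)` satisfies `δ_p ≤ δ_{g−p}` for
  `2p ≤ g` (`motivatedDefect_le_of_upper_abelianVariety`).

HONEST COLUMN. Nothing is discharged; row b05, `X`, `HC_AV` stay OPEN; «10 · 0» does not move. The converse transfer (lower half ⟹
upper half), the symmetry `δ_p = δ_{g−p}`, and a reduction of row b05 to the MIDDLE degree of even-dimensional abelian varieties (the
analogue of ab-spread-1's `HC_AV_iff_forall_middleDegree`) are NOT claimed: each needs `A_mot` to be stable under algebraic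
correspondences / exterior products (André Prop. 2.1 (ii), first inclusion), which rests on Lemme 1.3.2 (the Lefschetz involution of a
product polarisation through Künneth), absent on the real carriers (`Theorems.motivatedPullbackFst_of_core` isolates exactly that core).
For HODGE classes both directions hold (pull-backs of Hodge classes are Hodge), which is why `HC_AV` reduces to middle cells and row
b05, so far, only to its upper half. No rational refinement of §3 is claimed (the shadow `a` is a `ℂ`-combination).

References (bib keys): Andre1996Motifs (§2.1 Déf. 1, remark and Prop. 2.1 p. 14, proof p. 15; Lemme 1.3.2 p. 13; §6.2 p. 31),
Lieberman1968, Kleiman1968AlgebraicCycles (§2, App. Thm. 2A11; §3 Cor. 3.9), Grothendieck1968 (§3 p. 196), VoisinHodgeI2002 (Thm. 6.25,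
Rem. 6.27, §7.1.2), VoisinHodgeII2003 (§9.2.4 Prop. 9.20–9.21), FultonYoungTableaux1997 (App. B (6)), HatcherAT2002 (§3.3 Cor. 3.37).
-/

noncomputable section

set_option linter.dupNamespace false

open CategoryTheory AlgebraicGeometry MonoidalCategory CartesianMonoidalCategory
open Literature.AlgebraicTopology.SingularHomology Literature.Geometry.Kaehler
open Literature.AlgebraicGeometry Literature.AlgebraicGeometry.Motives
open Literature.AlgebraicGeometry.HodgeTheory
open Summit.HodgeConjecture.HodgeConjecture.Theses
open Summit.HodgeConjecture.HodgeConjecture.Ring2.AbelianAll (standardConjectureBStar_abelianVariety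
  map_mem_algebraicClasses_of_isAlgebraicCorrespondence nondegenerate_algebraicClasses_abelianVariety)

namespace Summit.HodgeConjecture.HodgeConjecture.Ring2.Hypotheses

/-! ## §1 The transfer: one algebraic bidegree of `*_L` moves `A_mot ⊆ A` from codimension `p + j` down to `p` -/

section Transfer

variable {n : ℕ} {X : SchemeOver ℂ}

/-- **`Lʲ_η A_motˡ(X)_ℂ ⊆ A_mot^{l+j}(X)_ℂ` for ANY divisor-supported `η ∈ N¹ H²(X(ℂ); ℂ)`** (André 1996, Prop. 2.1 (i) in the weak form
"motivated ∪ divisor class is motivated", the tree's unconditional `Theorems.cupProduct_divisor_mem_motivatedClasses`, iterated; `L c =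
η ∪ c = c ∪ η` in even degrees). The tree's `Theorems.lefschetzL_mem_motivatedClasses_of_mem` is the case `η = [H]` of a hard Lefschetz
datum. [cite: Andre1996Motifs, Prop. 2.1 (i) (p. 14) and proof (p. 15)] [cite: VoisinHodgeI2002, §6.2.3 and §7.1.2] -/
theorem lefschetzPowTo_mem_motivatedClasses_of_mem (hX : IsSmoothProjective n X) {η : complexBetti X 2}
    (hη : η ∈ algebraicClasses X 1) :
    ∀ (j l : ℕ) (hm : 2 * l + 2 * j = 2 * (l + j)) {c : complexBetti X (2 * l)},
      c ∈ motivatedClasses n X l → lefschetzPowTo η j (2 * l) (2 * (l + j)) hm c ∈ motivatedClasses n X (l + j)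
  | 0, l, hm, c, hc => by
    have h0 : lefschetzPowTo η 0 (2 * l) (2 * (l + 0)) hm c = c := rfl
    rw [h0]
    exact hc
  | j + 1, l, hm, c, hc => by
    rw [lefschetzPowTo_succ_apply η j (2 * l) (2 * (l + j)) (2 * (l + (j + 1))) (by omega) hm (by omega),
      lefschetzOperator_apply]
    have ih := lefschetzPowTo_mem_motivatedClasses_of_mem hX hη j l (by omega) hc
    rw [cupProduct_gradedComm_holds ℂ _ (show 2 + 2 * (l + j) = 2 * (l + (j + 1)) by omega)
      (show 2 * (l + j) + 2 * 1 = 2 * (l + (j + 1)) by omega) η _,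
      show ((-1 : ℂ) ^ (2 * (2 * (l + j)))) = 1 by rw [pow_mul, neg_one_sq, one_pow], one_smul]
    exact Theorems.cupProduct_divisor_mem_motivatedClasses hX _ ih hη

/-- **`*_L ∘ Lʲ = id` on `Hᵇ(X(ℂ); ℂ)`, `b + j = d`**, in the explicit-target-degree spelling `lefschetzPowTo` (bookkeeping form of
`lefschetzInvolution_lefschetzPow`). [cite: Andre1996Motifs, §0.2 (p. 7) and §1.1 (p. 10)] -/
theorem lefschetzInvolution_lefschetzPowTo {η : complexBetti X 2} {d : ℕ} (hL : HasHardLefschetzProperty η d)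
    {b j m : ℕ} (hj : b + j = d) (hm : b + 2 * j = m) (hab : m + b = 2 * d) (x : complexBetti X b) :
    lefschetzInvolution hL hab (lefschetzPowTo η j b m hm x) = x := by
  subst hm
  exact lefschetzInvolution_lefschetzPow hL hj hab x

/-- **THE TRANSFER.** `X` smooth projective of dimension `n`, `η` a polarisation class, `2p + j = n`. If André's `*_L : H^{2(p+j)}(X(ℂ))
→ H^{2p}(X(ℂ))` (the inverse of `Lʲ`) is induced by an algebraic correspondence — ONE bidegree of `B(X)` — and the motivated classes of
codimension `p + j = n − p` are algebraic, then so are those of codimension `p`: `ξ ∈ A_motᵖ ⟹ Lʲ ξ ∈ A_mot^{p+j}`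
(`lefschetzPowTo_mem_motivatedClasses_of_mem`) `⊆ N^{p+j}`, and `ξ = *_L (Lʲ ξ) ∈ Nᵖ` since algebraic correspondences preserve algebraic
classes (Voisin II Prop. 9.21; the tree's `AbelianAll.map_mem_algebraicClasses_of_isAlgebraicCorrespondence`, fact-free).
[cite: Andre1996Motifs, §2.1 remark following Déf. 1 and Prop. 2.1 (p. 14)] [cite: VoisinHodgeII2003, §9.2.4 Prop. 9.21]
[cite: Kleiman1968AlgebraicCycles, §2] -/
theorem motivatedClasses_le_algebraicClasses_of_upper_of_isAlgebraicCorrespondence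
    (hX : IsSmoothProjective n X) {η : complexBetti X 2} (hη : IsPolarizationClass n X η) {p j : ℕ}
    (hj : 2 * p + j = n)
    (hB : IsAlgebraicCorrespondence n n X X
      (lefschetzInvolution hη.hasHardLefschetz (show 2 * (p + j) + 2 * p = 2 * n by omega)))
    (hup : motivatedClasses n X (p + j) ≤ algebraicClasses X (p + j)) :
    motivatedClasses n X p ≤ algebraicClasses X p := by
  intro ξ hξ
  have hy : lefschetzPowTo η j (2 * p) (2 * (p + j)) (by omega) ξ ∈ algebraicClasses X (p + j) :=
    hup (lefschetzPowTo_mem_motivatedClasses_of_mem hX hη.mem_algebraicClasses j p (by omega) hξ)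
  have h := map_mem_algebraicClasses_of_isAlgebraicCorrespondence hX hX hB hy
  rwa [lefschetzInvolution_lefschetzPowTo hη.hasHardLefschetz (show 2 * p + j = n by omega)] at h

/-- **Under `B⋆(X, η)`, `A_mot(X) = A(X)` FOR `X` is its upper half**: if the motivated classes of codimension `p` with `n ≤ 2p` and `p
+ 2 ≤ n` are algebraic, then all are (`p ≤ 1` and `p + 1 ≥ n` are the binder-free Lefschetz range,
`motivatedClasses_le_algebraicClasses_of_lefschetzRange`; `2p < n` is the transfer from `n − p`, using only the bidegree `(2(n−p), 2p)`
of `B⋆(X, η)`). `B` is asked for `X` alone, not for the auxiliary products of the generators.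
[cite: Andre1996Motifs, §0.3 (pp. 7–8) and §2.1 remark following Déf. 1 (p. 14)] [cite: Grothendieck1968, §3 p. 196 (B(X))]
[cite: VoisinHodgeI2002, Thm. 6.25 and Thm. 11.30] -/
theorem forall_motivatedClasses_le_algebraicClasses_of_upperHalf_of_standardConjectureBStar
    (hX : IsSmoothProjective n X) {η : complexBetti X 2} (hη : IsPolarizationClass n X η)
    (hB : StandardConjectureBStar n X η)
    (hup : ∀ p : ℕ, n ≤ 2 * p → p + 2 ≤ n → motivatedClasses n X p ≤ algebraicClasses X p) (p : ℕ) :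
    motivatedClasses n X p ≤ algebraicClasses X p := by
  by_cases hp : p ≤ 1 ∨ n ≤ p + 1
  · exact motivatedClasses_le_algebraicClasses_of_lefschetzRange hX hp
  by_cases h2 : n ≤ 2 * p
  · exact hup p h2 (by omega)
  · obtain ⟨j, hj⟩ : ∃ j, 2 * p + j = n := ⟨n - 2 * p, by omega⟩
    exact motivatedClasses_le_algebraicClasses_of_upper_of_isAlgebraicCorrespondence hX hη hj (hB hη _ _ _)
      (hup (p + j) (by omega) (by omega))

end Transfer

/-! ## §2 Abelian varieties: Lieberman's `B(A)` makes the transfer unconditional — row b05 is its upper half -/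

section Abelian

/-- **On a complex abelian variety `A` of dimension `g`, `2p + j = g`: `A_mot^{g−p}(A) ⊆ N^{g−p}(A) ⟹ A_motᵖ(A) ⊆ Nᵖ(A)`**,
unconditionally — the transfer of §1 with `*_L` algebraic by Lieberman's theorem (Kleiman 2A11; the AbelianAll sub-cell's
`standardConjectureBStar_abelianVariety`, part XXII-c) for the hyperplane class of the tree's hard Lefschetz datum
(`nonempty_hardLefschetzNFold_holds`). [cite: Lieberman1968, main theorem] [cite: Kleiman1968AlgebraicCycles, Appendix to §2, Thm. 2A11]
[cite: Andre1996Motifs, §6.2 (p. 31)] -/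
theorem motivatedClasses_le_algebraicClasses_abelianVariety_of_upper (A : AbelianVariety ℂ) {p j : ℕ}
    (hj : 2 * p + j = A.dim) (hup : motivatedClasses A.dim A.X (p + j) ≤ algebraicClasses A.X (p + j)) :
    motivatedClasses A.dim A.X p ≤ algebraicClasses A.X p := by
  have hA : IsSmoothProjective A.dim A.X := AbelianVariety.isSmoothProjective_holds (A := A)
  obtain ⟨Λ⟩ := nonempty_hardLefschetzNFold_holds A.dim A.X hA
  exact motivatedClasses_le_algebraicClasses_of_upper_of_isAlgebraicCorrespondence hA Λ.isPolarizationClass hj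
    (standardConjectureBStar_abelianVariety A Λ.hyperplaneClass Λ.isPolarizationClass _ _ _) hup

/-- **Per abelian variety: if the motivated classes of codimension `p` with `g ≤ 2p ≤ 2g − 4` (cycle dimension `2 ≤ g − p ≤ g/2`) are
algebraic, ALL motivated classes on `A` are algebraic** (Lefschetz range + the transfer). [cite: Lieberman1968, main theorem]
[cite: Andre1996Motifs, §2.1 (p. 14) and §6.2 (p. 31)] [cite: VoisinHodgeI2002, Thm. 6.25 and Thm. 11.30] -/
theorem forall_motivatedClasses_le_algebraicClasses_abelianVariety_of_upperHalf (A : AbelianVariety ℂ)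
    (hup : ∀ p : ℕ, A.dim ≤ 2 * p → p + 2 ≤ A.dim → motivatedClasses A.dim A.X p ≤ algebraicClasses A.X p)
    (p : ℕ) : motivatedClasses A.dim A.X p ≤ algebraicClasses A.X p := by
  have hA : IsSmoothProjective A.dim A.X := AbelianVariety.isSmoothProjective_holds (A := A)
  obtain ⟨Λ⟩ := nonempty_hardLefschetzNFold_holds A.dim A.X hA
  exact forall_motivatedClasses_le_algebraicClasses_of_upperHalf_of_standardConjectureBStar hA
    Λ.isPolarizationClass (standardConjectureBStar_abelianVariety A Λ.hyperplaneClass) hup p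

/-- **ROW b05 IS ITS UPPER HALF**: `MotivatedImpliesAlgebraicAV ⟺` on every complex abelian variety `A` the motivated classes of
codimension `p` with `dim A ≤ 2p ≤ 2 dim A − 4` are algebraic (gen 0's residue `2 ≤ p ≤ dim A − 2`,
`motivatedImpliesAlgebraicAV_iff_middleRange`, cut at the middle by Lieberman's `*_L`). Fact-free; row b05 itself is NOT asserted.
[cite: Andre1996Motifs, Thm. 0.6.2 (p. 9), §2.1 (p. 14), §6.2 (p. 31)] [cite: Lieberman1968, main theorem] -/
theorem motivatedImpliesAlgebraicAV_iff_upperHalf :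
    MotivatedImpliesAlgebraicAV ↔
      ∀ (A : AbelianVariety ℂ) (p : ℕ), A.dim ≤ 2 * p → p + 2 ≤ A.dim →
        motivatedClasses A.dim A.X p ≤ algebraicClasses A.X p :=
  ⟨fun h A p _ _ ↦ h A p,
    fun h A p ↦ forall_motivatedClasses_le_algebraicClasses_abelianVariety_of_upperHalf A (h A) p⟩

/-- **Dimension `≤ 5`: ONE codimension carries row b05 on `A`, namely `p = dim A − 2` (motivated SURFACE classes)** — for `dim A = 4`
the middle `H⁴`, for `dim A = 5` the codimension-3 classes in `H⁶` (codimension 2 follows by the transfer); `dim A ≤ 3` is binder-free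
anyway (`motivatedImpliesAlgebraicAV_of_dim_le_three`). Unconditional implication; the hypothesis is NOT asserted.
[cite: Andre1996Motifs, §2.1 (p. 14) and §6.2 (p. 31)] [cite: Lieberman1968, main theorem] -/
theorem forall_motivatedClasses_le_algebraicClasses_abelianVariety_of_dim_le_five (A : AbelianVariety ℂ)
    (h5 : A.dim ≤ 5) (h : motivatedClasses A.dim A.X (A.dim - 2) ≤ algebraicClasses A.X (A.dim - 2))
    (p : ℕ) : motivatedClasses A.dim A.X p ≤ algebraicClasses A.X p := by
  refine forall_motivatedClasses_le_algebraicClasses_abelianVariety_of_upperHalf A (fun q hq hq2 ↦ ?_) p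
  obtain rfl : q = A.dim - 2 := by omega
  exact h

end Abelian

/-! ## §3 The numerical form of row b05: Lieberman's `D(A)` -/

section Numerical

/-- **Linear algebra of a pairing non-degenerate between two finite-dimensional subspaces, with values in a line**: if `B : M × N → T`,
`dim T = 1`, has trivial left kernel on `V ≤ M` against `W ≤ N` and trivial right kernel on `W` against `V`, then every `m ∈ M` has a
"shadow" `v ∈ V` with `B(v, w) = B(m, w)` for all `w ∈ W` (`V ↪ Hom(W, T)` and `W ↪ Hom(V, T)` force equal dimensions, so the first map
is onto). [folklore] -/
theorem exists_mem_forall_eq_of_nondegenerate {K M N T : Type*} [Field K] [AddCommGroup M] [Module K M]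
    [AddCommGroup N] [Module K N] [AddCommGroup T] [Module K T] [FiniteDimensional K M]
    [FiniteDimensional K N] [FiniteDimensional K T] (hT : Module.finrank K T = 1)
    (B : M →ₗ[K] N →ₗ[K] T) (V : Submodule K M) (W : Submodule K N)
    (h₁ : ∀ v ∈ V, (∀ w ∈ W, B v w = 0) → v = 0) (h₂ : ∀ w ∈ W, (∀ v ∈ V, B v w = 0) → w = 0) (m : M) :
    ∃ v ∈ V, ∀ w ∈ W, B v w = B m w := by
  set Φ : V →ₗ[K] (W →ₗ[K] T) := B.domRestrict₁₂ V W with hΦdef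
  set Ψ : W →ₗ[K] (V →ₗ[K] T) := (B.domRestrict₁₂ V W).flip with hΨdef
  have hΦ : Function.Injective Φ := by
    rw [injective_iff_map_eq_zero]
    intro v hv
    exact Subtype.ext (h₁ v v.2 fun w hw ↦ by
      simpa [hΦdef, LinearMap.domRestrict₁₂_apply] using LinearMap.congr_fun hv ⟨w, hw⟩)
  have hΨ : Function.Injective Ψ := by
    rw [injective_iff_map_eq_zero]
    intro w hw
    exact Subtype.ext (h₂ w w.2 fun v hv ↦ by
      simpa [hΨdef, LinearMap.domRestrict₁₂_apply] using LinearMap.congr_fun hw ⟨v, hv⟩)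
  have hWT : Module.finrank K (W →ₗ[K] T) = Module.finrank K W := by
    rw [Module.finrank_linearMap, hT, mul_one]
  have hVT : Module.finrank K (V →ₗ[K] T) = Module.finrank K V := by
    rw [Module.finrank_linearMap, hT, mul_one]
  have h1 := LinearMap.finrank_le_finrank_of_injective hΦ
  have h2 := LinearMap.finrank_le_finrank_of_injective hΨ
  rw [hWT] at h1
  rw [hVT] at h2
  have hsurj : Function.Surjective Φ :=
    (LinearMap.injective_iff_surjective_of_finrank_eq_finrank (by rw [hWT]; omega)).1 hΦ
  obtain ⟨v, hv⟩ := hsurj ((B m).domRestrict W)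
  refine ⟨v, v.2, fun w hw ↦ ?_⟩
  have := LinearMap.congr_fun hv ⟨w, hw⟩
  simpa [hΦdef, LinearMap.domRestrict₁₂_apply] using this

variable {n : ℕ} {X : SchemeOver ℂ}

/-- **`H²ⁿ(X(ℂ); ℂ)` is a line** for `X` smooth projective of dimension `n` (Poincaré duality `dim H²ⁿ = dim H⁰`, Hatcher Cor. 3.37, and
`H⁰ ≅ ℂ` for the path-connected `X(ℂ)`); same proof as the tree's `finrank_complexBetti_two_mul_eq_one`, restated to keep the imports
light. [cite: HatcherAT2002, §3.3 Cor. 3.37 and §3.1 p. 199] -/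
theorem finrank_complexBetti_top (hX : IsSmoothProjective n X) :
    Module.finrank ℂ (complexBetti X (2 * n)) = 1 := by
  haveI := pathConnectedSpace_complexPoints hX
  change Module.finrank ℂ (singularCohomology ℂ ℂ (ComplexPoints X) (2 * n)) = 1
  rw [ComplexPoints.finrank_singularCohomology_eq_of_add_eq ℂ hX (show 2 * n + 0 = 2 * n by omega),
    (singularCohomologyZeroEquiv ℂ ℂ (ComplexPoints X)).finrank_eq, Module.finrank_self]

/-- **NUMERICAL FORM, per `(A, p)`**: for a complex abelian variety `A` and `p + q = dim A`, `A_motᵖ(A)_ℂ ⊆ Nᵖ(A)` **iff** every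
motivated class of codimension `p` that is cup-orthogonal to `N^q(A)` vanishes. (⟹) is the left non-degeneracy of Lieberman's `D(A)`
(`AbelianAll.nondegenerate_algebraicClasses_abelianVariety`, part XXII-h). (⟸): by `D(A)` (both sides) and `dim H^{2g} = 1`, every `ξ ∈
H^{2p}` has `a ∈ Nᵖ` with `ξ − a ⊥ N^q` (`exists_mem_forall_eq_of_nondegenerate`); for `ξ` motivated, `ξ − a` is motivated (`A ⊆ A_mot`,
André §2.1, the tree's `algebraicClasses_le_motivatedClasses_of_nonempty_hardLefschetzNFold_self`), hence `0`, so `ξ = a ∈ Nᵖ`.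
[cite: Lieberman1968, main theorem] [cite: Kleiman1968AlgebraicCycles, §3 Cor. 3.9]
[cite: Andre1996Motifs, §2.1 remark following Déf. 1 (p. 14)] -/
theorem motivatedClasses_le_algebraicClasses_abelianVariety_iff_numerical (A : AbelianVariety ℂ) {p q : ℕ}
    (hpq : p + q = A.dim) :
    motivatedClasses A.dim A.X p ≤ algebraicClasses A.X p ↔
      ∀ ξ ∈ motivatedClasses A.dim A.X p,
        (∀ b ∈ algebraicClasses A.X q, cupProduct (show 2 * p + 2 * q = 2 * A.dim by omega) ξ b = 0) → ξ = 0 := by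
  have hA : IsSmoothProjective A.dim A.X := AbelianVariety.isSmoothProjective_holds (A := A)
  obtain ⟨hD₁, hD₂⟩ := nondegenerate_algebraicClasses_abelianVariety A hpq
  refine ⟨fun h ξ hξ h0 ↦ hD₁ ξ (h hξ) h0, fun h ξ hξ ↦ ?_⟩
  haveI := finite_complexBetti hA (2 * p)
  haveI := finite_complexBetti hA (2 * q)
  haveI := finite_complexBetti hA (2 * A.dim)
  obtain ⟨a, ha, hab⟩ := exists_mem_forall_eq_of_nondegenerate (finrank_complexBetti_top hA)
    (cupProduct (show 2 * p + 2 * q = 2 * A.dim by omega)) (algebraicClasses A.X p) (algebraicClasses A.X q)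
    hD₁ hD₂ ξ
  have hξa : ξ - a ∈ motivatedClasses A.dim A.X p :=
    sub_mem hξ (algebraicClasses_le_motivatedClasses_of_nonempty_hardLefschetzNFold_self hA
      (nonempty_hardLefschetzNFold_holds A.dim A.X) p ha)
  have h0 := h (ξ - a) hξa fun b hb ↦ by rw [map_sub, LinearMap.sub_apply, hab b hb, sub_self]
  rw [sub_eq_zero] at h0
  rw [h0]
  exact ha

/-- **NUMERICAL FORM OF ROW b05**: `MotivatedImpliesAlgebraicAV ⟺` for every complex abelian variety `A` and `p + q = dim A`, no
non-zero motivated class of codimension `p` is cup-orthogonal to the algebraic classes of codimension `q` — "every non-zero motivated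
class has a non-zero intersection number with some algebraic cycle of complementary dimension" (hom ≡ num between `A_mot(A)` and
`A(A)`). Degrees `p > dim A` are empty (`motivatedClasses_eq_bot_of_lt`). Fact-free; neither side is asserted.
[cite: Lieberman1968, main theorem] [cite: Kleiman1968AlgebraicCycles, §3 Cor. 3.9]
[cite: Andre1996Motifs, Thm. 0.6.2 (p. 9) and §2.1 (p. 14)] -/
theorem motivatedImpliesAlgebraicAV_iff_numerical :
    MotivatedImpliesAlgebraicAV ↔
      ∀ (A : AbelianVariety ℂ) (p q : ℕ) (hpq : p + q = A.dim), ∀ ξ ∈ motivatedClasses A.dim A.X p,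
        (∀ b ∈ algebraicClasses A.X q, cupProduct (show 2 * p + 2 * q = 2 * A.dim by omega) ξ b = 0) → ξ = 0 := by
  refine ⟨fun h A p q hpq ↦ (motivatedClasses_le_algebraicClasses_abelianVariety_iff_numerical A hpq).1 (h A p),
    fun h A p ↦ ?_⟩
  by_cases hp : p ≤ A.dim
  · obtain ⟨q, hpq⟩ : ∃ q, p + q = A.dim := ⟨A.dim - p, by omega⟩
    exact (motivatedClasses_le_algebraicClasses_abelianVariety_iff_numerical A hpq).2 (h A p q hpq)
  · rw [motivatedClasses_eq_bot_of_lt (not_le.1 hp)]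
    exact bot_le

/-- **ROW b05, numerical form cut at the middle**: `MotivatedImpliesAlgebraicAV ⟺` on every complex abelian variety, for `p + q = dim
A`, `2 ≤ q ≤ p`, every non-zero motivated class of codimension `p` (cycle dimension `q ≤ dim A / 2`) pairs non-trivially with some
algebraic class of codimension `q` (§2 with the per-`(A, p)` numerical form). Fact-free; neither side is asserted.
[cite: Lieberman1968, main theorem] [cite: Kleiman1968AlgebraicCycles, §3 Cor. 3.9 and Appendix to §2, Thm. 2A11]
[cite: Andre1996Motifs, Thm. 0.6.2 (p. 9) and §2.1 (p. 14)] -/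
theorem motivatedImpliesAlgebraicAV_iff_numerical_upperHalf :
    MotivatedImpliesAlgebraicAV ↔
      ∀ (A : AbelianVariety ℂ) (p q : ℕ) (hpq : p + q = A.dim), q ≤ p → 2 ≤ q →
        ∀ ξ ∈ motivatedClasses A.dim A.X p,
          (∀ b ∈ algebraicClasses A.X q, cupProduct (show 2 * p + 2 * q = 2 * A.dim by omega) ξ b = 0) →
            ξ = 0 := by
  refine ⟨fun h A p q hpq _ _ ↦ (motivatedClasses_le_algebraicClasses_abelianVariety_iff_numerical A hpq).1 (h A p),
    fun h A ↦ forall_motivatedClasses_le_algebraicClasses_abelianVariety_of_upperHalf A fun p hp hp2 ↦ ?_⟩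
  obtain ⟨q, hpq⟩ : ∃ q, p + q = A.dim := ⟨A.dim - p, by omega⟩
  exact (motivatedClasses_le_algebraicClasses_abelianVariety_iff_numerical A hpq).2
    (h A p q hpq (by omega) (by omega))

end Numerical

/-! ## §4 The rank form and the motivated defect -/

section Finrank

variable {n : ℕ} {X : SchemeOver ℂ}

/-- **Rank form, any smooth projective `X`**: since `Nᵖ(X) ⊆ A_motᵖ(X)` unconditionally (André §2.1 "il est clair"; the tree's
`algebraicClasses_le_motivatedClasses_of_nonempty_hardLefschetzNFold_self`), `A_motᵖ(X) ⊆ Nᵖ(X)` iff the two finite-dimensional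
`ℂ`-spaces have the same rank. [cite: Andre1996Motifs, §2.1 remark following Déf. 1 (p. 14)] -/
theorem motivatedClasses_le_algebraicClasses_iff_finrank_eq (hX : IsSmoothProjective n X) (p : ℕ) :
    motivatedClasses n X p ≤ algebraicClasses X p ↔
      Module.finrank ℂ (algebraicClasses X p) = Module.finrank ℂ (motivatedClasses n X p) := by
  haveI := finite_complexBetti hX (2 * p)
  have hle : algebraicClasses X p ≤ motivatedClasses n X p :=
    algebraicClasses_le_motivatedClasses_of_nonempty_hardLefschetzNFold_self hX
      (nonempty_hardLefschetzNFold_holds n X) p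
  refine ⟨fun h ↦ by rw [le_antisymm h hle], fun h ↦ ?_⟩
  exact (Submodule.eq_of_le_of_finrank_eq hle h).ge

/-- **`rk A_motᵖ(X) ≤ rk A_mot^{p+j}(X)` for `2p + j = n`**, any smooth projective `X`: `Lʲ` is injective on `H^{2p}` (hard Lefschetz,
`nonempty_hardLefschetzNFold_holds`) and maps `A_motᵖ` into `A_mot^{p+j}` (§1). [cite: VoisinHodgeI2002, Thm. 6.25]
[cite: Andre1996Motifs, Prop. 2.1 (i) (p. 14)] -/
theorem finrank_motivatedClasses_le_of_upper (hX : IsSmoothProjective n X) {p j : ℕ} (hj : 2 * p + j = n) :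
    Module.finrank ℂ (motivatedClasses n X p) ≤ Module.finrank ℂ (motivatedClasses n X (p + j)) := by
  haveI := finite_complexBetti hX (2 * (p + j))
  obtain ⟨Λ⟩ := nonempty_hardLefschetzNFold_holds n X hX
  have hinj : Function.Injective (Λ.L j (2 * p) (2 * (p + j)) (by omega)) :=
    (Λ.bijective_L (show 2 * p + j = n by omega) _ _).1
  rw [LinearEquiv.finrank_eq (Submodule.equivMapOfInjective _ hinj (motivatedClasses n X p))]
  refine Submodule.finrank_mono (Submodule.map_le_iff_le_comap.2 fun c hc ↦ ?_)
  exact lefschetzPowTo_mem_motivatedClasses_of_mem hX Λ.hyperplaneClass_mem j p (by omega) hc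

/-- **`rk Nᵖ(A) = rk N^{g−p}(A)` on a complex abelian variety** (`2p + j = g`): `Lʲ : Nᵖ ↪ N^{p+j}`
(`HardLefschetzNFold.L_mem_algebraicClasses_of_mem`) and `*_L : N^{p+j} ↪ Nᵖ` (Lieberman), both injective.
[cite: Lieberman1968, main theorem] [cite: Kleiman1968AlgebraicCycles, §2 and Appendix, Thm. 2A11]
[cite: VoisinHodgeII2003, §9.2.4 Prop. 9.20–9.21] -/
theorem finrank_algebraicClasses_eq_of_upper_abelianVariety (A : AbelianVariety ℂ) {p j : ℕ}
    (hj : 2 * p + j = A.dim) :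
    Module.finrank ℂ (algebraicClasses A.X p) = Module.finrank ℂ (algebraicClasses A.X (p + j)) := by
  have hA : IsSmoothProjective A.dim A.X := AbelianVariety.isSmoothProjective_holds (A := A)
  haveI := finite_complexBetti hA (2 * (p + j))
  haveI := finite_complexBetti hA (2 * p)
  obtain ⟨Λ⟩ := nonempty_hardLefschetzNFold_holds A.dim A.X hA
  refine le_antisymm ?_ ?_
  · have hinj : Function.Injective (Λ.L j (2 * p) (2 * (p + j)) (by omega)) :=
      (Λ.bijective_L (show 2 * p + j = A.dim by omega) _ _).1
    rw [LinearEquiv.finrank_eq (Submodule.equivMapOfInjective _ hinj (algebraicClasses A.X p))]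
    exact Submodule.finrank_mono (Submodule.map_le_iff_le_comap.2 fun c hc ↦
      Λ.L_mem_algebraicClasses_of_mem j p (by omega) hc)
  · have hab : 2 * (p + j) + 2 * p = 2 * A.dim := by omega
    have hinj : Function.Injective (lefschetzInvolution Λ.hasHardLefschetz hab) :=
      (lefschetzInvolution_bijective Λ.hasHardLefschetz hab).1
    rw [LinearEquiv.finrank_eq (Submodule.equivMapOfInjective _ hinj (algebraicClasses A.X (p + j)))]
    exact Submodule.finrank_mono (Submodule.map_le_iff_le_comap.2 fun c hc ↦
      map_mem_algebraicClasses_of_isAlgebraicCorrespondence hA hA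
        (standardConjectureBStar_abelianVariety A Λ.hyperplaneClass Λ.isPolarizationClass _ _ hab) hc)

/-- **THE MOTIVATED DEFECT IS MONOTONE TOWARDS THE UPPER HALF**: with `δ_p(A) := rk A_motᵖ(A) − rk Nᵖ(A) ≥ 0` (row b05 at `(A, p)` says
`δ_p(A) = 0`, `motivatedClasses_le_algebraicClasses_iff_finrank_eq`), `δ_p(A) ≤ δ_{g−p}(A)` for `2p ≤ g` — written without subtraction.
The reverse inequality is NOT claimed (module docstring, HONEST COLUMN). [cite: Lieberman1968, main theorem]
[cite: Andre1996Motifs, Prop. 2.1 (p. 14) and Lemme 1.3.2 (p. 13)] -/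
theorem motivatedDefect_le_of_upper_abelianVariety (A : AbelianVariety ℂ) {p j : ℕ} (hj : 2 * p + j = A.dim) :
    Module.finrank ℂ (motivatedClasses A.dim A.X p) + Module.finrank ℂ (algebraicClasses A.X (p + j)) ≤
      Module.finrank ℂ (motivatedClasses A.dim A.X (p + j)) + Module.finrank ℂ (algebraicClasses A.X p) := by
  rw [finrank_algebraicClasses_eq_of_upper_abelianVariety A hj]
  exact Nat.add_le_add_right
    (finrank_motivatedClasses_le_of_upper (AbelianVariety.isSmoothProjective_holds (A := A)) hj) _

end Finrank

end Summit.HodgeConjecture.HodgeConjecture.Ring2.Hypotheses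

end
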